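import Summits.CriticalPhenomena.PercolationContinuityZ3.Theorems.SahiMasterFamilyHalfRootable
import Summits.CriticalPhenomena.PercolationContinuityZ3.Theorems.SahiMasterFamilyCBar

/-!
# The typed SIDE CRITERION of the block expansion and the reduction "side criterion at some root of every restriction ⇒ conjecture (B♮)",
# every order

Unit `prim-masterthm-p4` (gen 26; crux anchor stmt-CriticalPhenomena-4575, helper work; memo
`run/shared/lean/prim/prim-masterthm/prim-masterthm-p4/P4-GEN26-REPORT.md` §1–§4).  Companion of `…StarAbsorption`, `…HalfRootable` (the side
identity `P_T(𝒰,𝒱) = P_T(𝒰 ∪ star z, 𝒱) + Σ_{B∋z, B∉𝒰} (|B|−1)!·w·(−κ_B)` and the half-rootable theorem) and `…CBar` (gen 24: the ROOT-SUMMED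
criterion (C̄) and its reduction; `rooted`).

THE CRITERION (memo §4).  Root the pair at `z` (relabel `z ↦ last`).  A block `B ∋ z`, `B ≠ T`, `B ∉ 𝒰` is a GOOD SIDE BLOCK if its complement
`T ∖ B` lies in `𝒰 ∪ 𝒱` (then `P_{T∖B} ≥_B 0` is conjecture (B♮) one order down); the remaining blocks outside `𝒰` have `P_{T∖B} ≤_B 0` by the sign
law of `…UCBernsteinUpper` (and `= 0` unless `T ∖ B` splits as `A ⊔ A'`, `A ∈ 𝒰`, `A' ∈ 𝒱`).  The SIDE SLACK at the root is
  `sideSlack 𝒰 𝒱 w = P_T(w) − Σ_{good side blocks B} (|B|−1)!·w·P_{T∖B}(w)`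
  `             = P_T(𝒰 ∪ star z, 𝒱)(w) + Σ_{B∋z, B∉𝒰, T∖B ∉ 𝒰∪𝒱} (|B|−1)!·w·P_{T∖B}(w)`   (`sideSlack_eq_star_add`, for `T ∈ 𝒰`),
the first summand Bernstein-positive by STAR ABSORPTION, the second `≤_B 0`.

**TYPED CONJECTURE `SideCrit n` (∃ root):** for every pair of union-closed families on `Fin (n+1)` with `univ ∈ 𝒰` there is a root `z` at which
`sideSlack (rooted z 𝒰) (rooted z 𝒱)` is `BPos (n+1)`.  DATA (memo §4, exact enumeration outside the kernel): SOME root works for every pair tested —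
all 19 891 190 480 ordered two-sided pairs (both sides) and all 171 602 480 one-sided pairs on 5 points (exhaustive, kit jobs j232358–60 of this unit),
all pairs on ≤ 4 points, 8·10⁸ / 1.6·10⁸ random pairs on 6 / 7 points, adversarial hill-climbing on 6–7 points and every structured witness of gens
20–24 (crossing designs, bi-glued and bi-principal pairs, the k = 9 apex pair refuting C1-natural).  The heuristic RULE "a root in a member of `𝒰` of
minimum cardinality" is exact for two-sided pairs on ≤ 5 points (7.4·10¹⁰ root tests) but fails at 7 points (adversarial dense witnesses), so the
conjecture is stated with an existential root.  Weaker than gen 22's C1(z) (whose fixed-root forms are refuted): the `(1−w)`-weighted blocks are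
absorbed, not estimated.

**THEOREM (`bpos_mix_of_sideCrit`, every order):** `(∀ m ≤ n, SideCrit m)` ⇒ for every pair of union-closed families on `Fin (n+1)` with
`univ ∈ 𝒰 ∪ 𝒱` the edge polynomial is `BPos (n+1)` — conjecture (B♮), in particular (B).  PROOF: strong induction; mirror so that `univ ∈ 𝒰`;
root at the `z` of the criterion; `P_T = sideSlack + Σ_{good side blocks} (|B|−1)!·w·P_{T∖B}` with every `P_{T∖B}` an edge polynomial of a
pulled-back pair whose top lies in `𝒰 ∪ 𝒱`, `BPos` by induction.
HONEST FRAMING: a definition, a typed conjecture and a proved reduction; `SideCrit`, (B), `UCHullNonneg k` (k ≥ 8), Sahi's `C_k` and the master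
theorem remain OPEN.  Axioms standard. [this work]
-/

noncomputable section

open scoped Classical

namespace Summit.CriticalPhenomena.PercolationContinuityZ3.Theorems

namespace SideExpansion

open Finset Function Equiv
open Literature.Combinatorics.Sahi2008
open Literature.Combinatorics.Sahi2008.CycleForm
open PrincipalCapBeta (phiSet realF realW)
open BernsteinPos UCBernsteinNested UCBernsteinRootable StarAbsorption RootSummed

variable {n : ℕ}

/-! ### Good side blocks and the side slack (at the last index) -/

/-- GOOD SIDE BLOCKS of `(𝒰, 𝒱)` at the last index: proper blocks `B ∋ last` outside `𝒰` whose complement lies in `𝒰 ∪ 𝒱`. [this work] -/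
def goodSideBlocks (𝒰 𝒱 : Finset (Finset (Fin (n + 1)))) : Finset (Finset (Fin (n + 1))) :=
  univ.filter fun B => Fin.last n ∈ B ∧ B ≠ univ ∧ B ∉ 𝒰 ∧ (univ \ B ∈ 𝒰 ∨ univ \ B ∈ 𝒱)

/-- The `w`-weighted block term `(|B|−1)!·w·(−κ_B)` (`−κ_B` = edge polynomial of the restriction to `univ ∖ B`). [this work] -/
def sideTerm (𝒰 𝒱 : Finset (Finset (Fin (n + 1)))) (B : Finset (Fin (n + 1))) (w : ℝ) : ℝ :=
  ((B.card - 1).factorial : ℝ) * (w * (-coRest (realW (mix 𝒰 𝒱 w)) realF B))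

/-- **The side slack** at the last index: `P_T − Σ_{good side blocks} (|B|−1)!·w·P_{T∖B}`. [this work] -/
def sideSlack (𝒰 𝒱 : Finset (Finset (Fin (n + 1)))) (w : ℝ) : ℝ :=
  phiSet (n + 1) (mix 𝒰 𝒱 w) - ∑ B ∈ goodSideBlocks 𝒰 𝒱, sideTerm 𝒰 𝒱 B w

/-- The side slack splits as the STAR-ABSORBED edge polynomial plus the `w`-weighted terms of the blocks outside `𝒰` that are not good side
blocks (for `univ ∈ 𝒰`: the blocks whose complement lies in neither family, each `≤_B 0` by the sign law). [this work] -/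
theorem sideSlack_eq_star_add (𝒰 𝒱 : Finset (Finset (Fin (n + 1)))) (w : ℝ) :
    sideSlack 𝒰 𝒱 w = phiSet (n + 1) (mix (𝒰 ∪ star (Fin.last n)) 𝒱 w) +
      ∑ B ∈ univ.filter (fun B : Finset (Fin (n + 1)) => Fin.last n ∈ B ∧ B ∉ 𝒰 ∧ ¬(B ≠ univ ∧ (univ \ B ∈ 𝒰 ∨ univ \ B ∈ 𝒱))),
        sideTerm 𝒰 𝒱 B w := by
  unfold sideSlack
  rw [phiSet_mix_eq_star_add 𝒰 𝒱 w]
  -- the blocks through `last`: those in `𝒰` contribute `0`; the others split into good side blocks and the rest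
  have hsum : ∑ B ∈ univ.filter (fun B : Finset (Fin (n + 1)) => Fin.last n ∈ B),
      ((B.card - 1).factorial : ℝ) * ((if B ∈ 𝒰 then (0 : ℝ) else w) * (-coRest (realW (mix 𝒰 𝒱 w)) realF B)) =
      ∑ B ∈ univ.filter (fun B : Finset (Fin (n + 1)) => Fin.last n ∈ B ∧ B ∉ 𝒰), sideTerm 𝒰 𝒱 B w := by
    rw [← Finset.sum_filter_add_sum_filter_not (univ.filter fun B : Finset (Fin (n + 1)) => Fin.last n ∈ B) (fun B => B ∉ 𝒰)]
    have h0 : ∑ B ∈ (univ.filter fun B : Finset (Fin (n + 1)) => Fin.last n ∈ B).filter (fun B => ¬(B ∉ 𝒰)),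
        ((B.card - 1).factorial : ℝ) * ((if B ∈ 𝒰 then (0 : ℝ) else w) * (-coRest (realW (mix 𝒰 𝒱 w)) realF B)) = 0 := by
      refine sum_eq_zero fun B hB => ?_
      have hBU : B ∈ 𝒰 := not_not.1 (mem_filter.1 hB).2
      rw [if_pos hBU]; ring
    rw [h0, add_zero, Finset.filter_filter]
    refine sum_congr rfl fun B hB => ?_
    have hBU : B ∉ 𝒰 := (mem_filter.1 hB).2.2
    unfold sideTerm; rw [if_neg hBU]
  have hsplit : ∑ B ∈ univ.filter (fun B : Finset (Fin (n + 1)) => Fin.last n ∈ B ∧ B ∉ 𝒰), sideTerm 𝒰 𝒱 B w =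
      (∑ B ∈ goodSideBlocks 𝒰 𝒱, sideTerm 𝒰 𝒱 B w) +
      ∑ B ∈ univ.filter (fun B : Finset (Fin (n + 1)) => Fin.last n ∈ B ∧ B ∉ 𝒰 ∧ ¬(B ≠ univ ∧ (univ \ B ∈ 𝒰 ∨ univ \ B ∈ 𝒱))),
        sideTerm 𝒰 𝒱 B w := by
    rw [← Finset.sum_filter_add_sum_filter_not (univ.filter fun B : Finset (Fin (n + 1)) => Fin.last n ∈ B ∧ B ∉ 𝒰)
      (fun B => B ≠ univ ∧ (univ \ B ∈ 𝒰 ∨ univ \ B ∈ 𝒱))]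
    unfold goodSideBlocks
    rw [Finset.filter_filter, Finset.filter_filter]
    congr 1
    · refine Finset.sum_congr ?_ fun _ _ => rfl
      ext B; simp only [mem_filter, mem_univ, true_and]; tauto
    · refine Finset.sum_congr ?_ fun _ _ => rfl
      ext B; simp only [mem_filter, mem_univ, true_and, and_assoc]
  rw [hsum, hsplit]
  ring

/-! ### The typed conjecture -/

/-- **CONJECTURE (SIDE CRITERION) at order `n+1`** (memo §4): for every pair of union-closed families on `Fin (n+1)` with `univ ∈ 𝒰` there is
a root `z` at which the side slack of the rooted pair is Bernstein-positive of degree `n+1`: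
`P_T ≥_B Σ_{B ∋ z, B ≠ T, B ∉ 𝒰, T∖B ∈ 𝒰∪𝒱} (|B|−1)!·w·P_{T∖B}`.  Numerically (exact enumeration outside the kernel): some root works for every
pair on ≤ 5 points (exhaustive), for 10⁹ random pairs on 6–7 points, under adversarial search on 6–7 points and for every structured witness of the
programme (the "minimum-member root" heuristic is exact on ≤ 5 points and fails at 7).  With `bpos_mix_of_sideCrit` it implies conjecture (B♮)
(hence (B)) at every order.  A conjecture-valued definition, never a fact. [this work]
[status: open; true on ≤ 5 points by exhaustive enumeration outside the kernel] -/
@[conjecture] def SideCrit (n : ℕ) : Prop :=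
  ∀ 𝒰 𝒱 : Finset (Finset (Fin (n + 1))),
    (∀ A ∈ 𝒰, ∀ B ∈ 𝒰, A ∪ B ∈ 𝒰) → (∀ A ∈ 𝒱, ∀ B ∈ 𝒱, A ∪ B ∈ 𝒱) → univ ∈ 𝒰 →
      ∃ z : Fin (n + 1), BPos (n + 1) (sideSlack (rooted z 𝒰) (rooted z 𝒱))

/-! ### The reduction -/

/-- At the last index: if the side slack is `BPos (n+1)` and every good side block carries a Bernstein-positive restricted edge polynomial, the
edge polynomial is `BPos (n+1)`. [this work] -/
theorem bpos_of_sideSlack_last (𝒰 𝒱 : Finset (Finset (Fin (n + 1)))) (hslack : BPos (n + 1) (sideSlack 𝒰 𝒱))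
    (hgood : ∀ (m : ℕ) (e : Fin (m + 1) ↪ Fin (n + 1)), m < n → (univ ∈ comap e 𝒰 ∨ univ ∈ comap e 𝒱) →
      BPos (m + 1) (fun w => phiSet (m + 1) (mix (comap e 𝒰) (comap e 𝒱) w))) :
    BPos (n + 1) (fun w => phiSet (n + 1) (mix 𝒰 𝒱 w)) := by
  have hterms : BPos (n + 1) (fun w => ∑ B ∈ goodSideBlocks 𝒰 𝒱, sideTerm 𝒰 𝒱 B w) := by
    refine BPos.sum _ (fun B w => sideTerm 𝒰 𝒱 B w) fun B hB => ?_
    obtain ⟨hlB, hBu, _, hgoodB⟩ := (mem_filter.1 hB).2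
    obtain ⟨m, e, he, hsurj, hc⟩ := exists_emb_coRest' hBu
    have hm : m < n := PhiVertex.lt_of_emb_ne_last e fun j hj => he j (by rw [hj]; exact hlB)
    have hrange : (univ : Finset (Fin (m + 1))).map e = univ \ B := map_univ_eq_sdiff e he hsurj
    have htop : univ ∈ comap e 𝒰 ∨ univ ∈ comap e 𝒱 := by
      rw [mem_comap, mem_comap, hrange]; exact hgoodB
    have key := hgood m e hm htop
    have hneg : BPos n (fun w => -coRest (realW (mix 𝒰 𝒱 w)) realF B) :=
      (key.mono (by omega)).congr fun w => by rw [hc, mix_map, neg_neg]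
    exact ((bpos_id.mul hneg).mono (by omega)).smul (Nat.cast_nonneg _)
  exact (hslack.add hterms).congr fun w => by unfold sideSlack; ring

/-- **THEOREM (every order).**  The side criterion at all orders `≤ n` implies conjecture (B♮) at order `n+1`: every pair of union-closed
families on `Fin (n+1)` whose top lies in at least one family has a Bernstein-positive edge polynomial. [this work] -/
theorem bpos_mix_of_sideCrit : ∀ (n : ℕ), (∀ m ≤ n, SideCrit m) → ∀ (𝒰 𝒱 : Finset (Finset (Fin (n + 1)))),
    (∀ A ∈ 𝒰, ∀ B ∈ 𝒰, A ∪ B ∈ 𝒰) → (∀ A ∈ 𝒱, ∀ B ∈ 𝒱, A ∪ B ∈ 𝒱) → (univ ∈ 𝒰 ∨ univ ∈ 𝒱) →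
      BPos (n + 1) (fun w => phiSet (n + 1) (mix 𝒰 𝒱 w)) := by
  intro n
  induction n using Nat.strong_induction_on with
  | _ n ih =>
  intro hcrit
  -- the `𝒰`-side case, for every pair at this order
  have sideU : ∀ (𝒰 𝒱 : Finset (Finset (Fin (n + 1)))), (∀ A ∈ 𝒰, ∀ B ∈ 𝒰, A ∪ B ∈ 𝒰) →
      (∀ A ∈ 𝒱, ∀ B ∈ 𝒱, A ∪ B ∈ 𝒱) → univ ∈ 𝒰 → BPos (n + 1) (fun w => phiSet (n + 1) (mix 𝒰 𝒱 w)) := by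
    intro 𝒰 𝒱 hU hV htop
    obtain ⟨z, hz⟩ := hcrit n le_rfl 𝒰 𝒱 hU hV htop
    have h := bpos_of_sideSlack_last (rooted z 𝒰) (rooted z 𝒱) hz fun m e hm htop' =>
      ih m hm (fun m' hm' => hcrit m' (by omega)) _ _ (comap_unionClosed e _ (rooted_unionClosed z hU))
        (comap_unionClosed e _ (rooted_unionClosed z hV)) htop'
    exact h.congr fun w => phiSet_mix_rooted z 𝒰 𝒱 w
  intro 𝒰 𝒱 hU hV htop
  rcases htop with htopU | htopV
  · exact sideU 𝒰 𝒱 hU hV htopU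
  · exact (sideU 𝒱 𝒰 hV hU htopV).reflect.congr fun w => by rw [mix_swap]

/-- COROLLARY: the side criterion at all orders `≤ n` implies conjecture (B) (two-sided tops) at order `n+1`. [this work] -/
theorem bpos_mix_of_sideCrit_both (hcrit : ∀ m ≤ n, SideCrit m) (𝒰 𝒱 : Finset (Finset (Fin (n + 1))))
    (hU : ∀ A ∈ 𝒰, ∀ B ∈ 𝒰, A ∪ B ∈ 𝒰) (hV : ∀ A ∈ 𝒱, ∀ B ∈ 𝒱, A ∪ B ∈ 𝒱) (htop : univ ∈ 𝒰) :
    BPos (n + 1) (fun w => phiSet (n + 1) (mix 𝒰 𝒱 w)) :=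
  bpos_mix_of_sideCrit n hcrit 𝒰 𝒱 hU hV (Or.inl htop)

/-! ### Root mixtures: the weakest form of the criterion that still implies (B♮) -/

/-- **CONJECTURE (MIXED SIDE CRITERION) at order `n+1`**: for every pair of union-closed families with `univ ∈ 𝒰` some CONVEX COMBINATION over
roots (and, when `univ ∈ 𝒱` too, over the roots of the mirror pair, read at `1 − w`) of the side slacks is Bernstein-positive.  `SideCrit n` is the
case of a point mass; the uniform mixture over the roots of one side is the root-summed form `k·P_T ≥_B Σ_{B∉𝒰, T∖B good} |B|!·w·P_{T∖B}` (memo §4: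
true for every two-sided pair on 4 points, false for 15 one-sided ones).  A conjecture-valued definition, never a fact. [this work]
[status: open; implied by `SideCrit n`] -/
@[conjecture] def SideCritMix (n : ℕ) : Prop :=
  ∀ 𝒰 𝒱 : Finset (Finset (Fin (n + 1))),
    (∀ A ∈ 𝒰, ∀ B ∈ 𝒰, A ∪ B ∈ 𝒰) → (∀ A ∈ 𝒱, ∀ B ∈ 𝒱, A ∪ B ∈ 𝒱) → univ ∈ 𝒰 →
      ∃ θ θ' : Fin (n + 1) → ℝ, (∀ z, 0 ≤ θ z) ∧ (∀ z, 0 ≤ θ' z) ∧ (∑ z, θ z + ∑ z, θ' z = 1) ∧ (univ ∉ 𝒱 → ∀ z, θ' z = 0) ∧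
        BPos (n + 1) (fun w => ∑ z, θ z * sideSlack (rooted z 𝒰) (rooted z 𝒱) w +
          ∑ z, θ' z * sideSlack (rooted z 𝒱) (rooted z 𝒰) (1 - w))

/-- A point mass is a mixture: `SideCrit n → SideCritMix n`. [this work] -/
theorem sideCritMix_of_sideCrit (h : SideCrit n) : SideCritMix n := by
  intro 𝒰 𝒱 hU hV htop
  obtain ⟨z, hz⟩ := h 𝒰 𝒱 hU hV htop
  let θ : Fin (n + 1) → ℝ := fun y => if y = z then 1 else 0
  have hθ : ∀ y, θ y = if y = z then 1 else 0 := fun _ => rfl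
  refine ⟨θ, fun _ => 0, fun y => ?_, fun _ => le_rfl, ?_, fun _ _ => rfl, ?_⟩
  · rw [hθ]
    by_cases hy : y = z
    · rw [if_pos hy]; exact zero_le_one
    · rw [if_neg hy]
  · rw [Finset.sum_congr rfl fun y _ => hθ y, Finset.sum_ite_eq' univ z (fun _ => (1 : ℝ)), if_pos (mem_univ z),
      Finset.sum_const_zero, add_zero]
  · refine hz.congr fun w => ?_
    rw [Finset.sum_eq_single z (fun y _ hy => by rw [hθ, if_neg hy, zero_mul]) (fun h => absurd (mem_univ z) h), hθ, if_pos rfl,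
      one_mul]
    simp only [zero_mul, Finset.sum_const_zero, add_zero]

/-- The edge polynomial splits, at every root of either side, as slack plus good side terms (the `𝒱`-side read at `1 − w`). [this work] -/
theorem phiSet_mix_eq_slack_add_good_U (𝒰 𝒱 : Finset (Finset (Fin (n + 1)))) (z : Fin (n + 1)) (w : ℝ) :
    phiSet (n + 1) (mix 𝒰 𝒱 w) =
      sideSlack (rooted z 𝒰) (rooted z 𝒱) w + ∑ B ∈ goodSideBlocks (rooted z 𝒰) (rooted z 𝒱), sideTerm (rooted z 𝒰) (rooted z 𝒱) B w := by
  rw [← phiSet_mix_rooted z 𝒰 𝒱 w]; unfold sideSlack; ring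

/-- The same split on the `𝒱` side, read at `1 − w`. [this work] -/
theorem phiSet_mix_eq_slack_add_good_V (𝒰 𝒱 : Finset (Finset (Fin (n + 1)))) (z : Fin (n + 1)) (w : ℝ) :
    phiSet (n + 1) (mix 𝒰 𝒱 w) =
      sideSlack (rooted z 𝒱) (rooted z 𝒰) (1 - w) +
        ∑ B ∈ goodSideBlocks (rooted z 𝒱) (rooted z 𝒰), sideTerm (rooted z 𝒱) (rooted z 𝒰) B (1 - w) := by
  rw [← mix_swap 𝒰 𝒱 w, ← phiSet_mix_rooted z 𝒱 𝒰 (1 - w)]; unfold sideSlack; ring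

/-- The good side terms at a root are `BPos (n+1)` once the restricted edge polynomials with a top in `𝒰 ∪ 𝒱` are (one order down). [this work] -/
theorem bpos_goodSideTerms (𝒰 𝒱 : Finset (Finset (Fin (n + 1))))
    (hgood : ∀ (m : ℕ) (e : Fin (m + 1) ↪ Fin (n + 1)), m < n → (univ ∈ comap e 𝒰 ∨ univ ∈ comap e 𝒱) →
      BPos (m + 1) (fun w => phiSet (m + 1) (mix (comap e 𝒰) (comap e 𝒱) w))) :
    BPos (n + 1) (fun w => ∑ B ∈ goodSideBlocks 𝒰 𝒱, sideTerm 𝒰 𝒱 B w) := by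
  refine BPos.sum _ (fun B w => sideTerm 𝒰 𝒱 B w) fun B hB => ?_
  obtain ⟨hlB, hBu, _, hgoodB⟩ := (mem_filter.1 hB).2
  obtain ⟨m, e, he, hsurj, hc⟩ := exists_emb_coRest' hBu
  have hm : m < n := PhiVertex.lt_of_emb_ne_last e fun j hj => he j (by rw [hj]; exact hlB)
  have hrange : (univ : Finset (Fin (m + 1))).map e = univ \ B := map_univ_eq_sdiff e he hsurj
  have htop : univ ∈ comap e 𝒰 ∨ univ ∈ comap e 𝒱 := by
    rw [mem_comap, mem_comap, hrange]; exact hgoodB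
  have hneg : BPos n (fun w => -coRest (realW (mix 𝒰 𝒱 w)) realF B) :=
    ((hgood m e hm htop).mono (by omega)).congr fun w => by rw [hc, mix_map, neg_neg]
  exact ((bpos_id.mul hneg).mono (by omega)).smul (Nat.cast_nonneg _)

/-- **THEOREM (every order).**  The MIXED side criterion at all orders `≤ n` implies conjecture (B♮) at order `n+1`. [this work] -/
theorem bpos_mix_of_sideCritMix : ∀ (n : ℕ), (∀ m ≤ n, SideCritMix m) → ∀ (𝒰 𝒱 : Finset (Finset (Fin (n + 1)))),
    (∀ A ∈ 𝒰, ∀ B ∈ 𝒰, A ∪ B ∈ 𝒰) → (∀ A ∈ 𝒱, ∀ B ∈ 𝒱, A ∪ B ∈ 𝒱) → (univ ∈ 𝒰 ∨ univ ∈ 𝒱) →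
      BPos (n + 1) (fun w => phiSet (n + 1) (mix 𝒰 𝒱 w)) := by
  intro n
  induction n using Nat.strong_induction_on with
  | _ n ih =>
  intro hcrit
  have sideU : ∀ (𝒰 𝒱 : Finset (Finset (Fin (n + 1)))), (∀ A ∈ 𝒰, ∀ B ∈ 𝒰, A ∪ B ∈ 𝒰) →
      (∀ A ∈ 𝒱, ∀ B ∈ 𝒱, A ∪ B ∈ 𝒱) → univ ∈ 𝒰 → BPos (n + 1) (fun w => phiSet (n + 1) (mix 𝒰 𝒱 w)) := by
    intro 𝒰 𝒱 hU hV htop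
    obtain ⟨θ, θ', hθ, hθ', hsum, hθ'0, hslack⟩ := hcrit n le_rfl 𝒰 𝒱 hU hV htop
    -- restricted pairs with a top are `BPos` by induction (both orientations)
    have hrec : ∀ (𝒰₁ 𝒱₁ : Finset (Finset (Fin (n + 1)))), (∀ A ∈ 𝒰₁, ∀ B ∈ 𝒰₁, A ∪ B ∈ 𝒰₁) →
        (∀ A ∈ 𝒱₁, ∀ B ∈ 𝒱₁, A ∪ B ∈ 𝒱₁) → ∀ (m : ℕ) (e : Fin (m + 1) ↪ Fin (n + 1)), m < n →
        (univ ∈ comap e 𝒰₁ ∨ univ ∈ comap e 𝒱₁) → BPos (m + 1) (fun w => phiSet (m + 1) (mix (comap e 𝒰₁) (comap e 𝒱₁) w)) :=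
      fun 𝒰₁ 𝒱₁ hU₁ hV₁ m e hm htop' => ih m hm (fun m' hm' => hcrit m' (by omega)) _ _
        (comap_unionClosed e _ hU₁) (comap_unionClosed e _ hV₁) htop'
    have goodU : ∀ z, BPos (n + 1) (fun w => ∑ B ∈ goodSideBlocks (rooted z 𝒰) (rooted z 𝒱), sideTerm (rooted z 𝒰) (rooted z 𝒱) B w) :=
      fun z => bpos_goodSideTerms _ _ (hrec _ _ (rooted_unionClosed z hU) (rooted_unionClosed z hV))
    have goodV : ∀ z, BPos (n + 1) (fun w => ∑ B ∈ goodSideBlocks (rooted z 𝒱) (rooted z 𝒰), sideTerm (rooted z 𝒱) (rooted z 𝒰) B (1 - w)) :=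
      fun z => (bpos_goodSideTerms _ _ (hrec _ _ (rooted_unionClosed z hV) (rooted_unionClosed z hU))).reflect
    have hgoodmix : BPos (n + 1) (fun w => ∑ z, θ z * ∑ B ∈ goodSideBlocks (rooted z 𝒰) (rooted z 𝒱), sideTerm (rooted z 𝒰) (rooted z 𝒱) B w +
        ∑ z, θ' z * ∑ B ∈ goodSideBlocks (rooted z 𝒱) (rooted z 𝒰), sideTerm (rooted z 𝒱) (rooted z 𝒰) B (1 - w)) :=
      (BPos.sum univ (fun z w => θ z * _) fun z _ => (goodU z).smul (hθ z)).add
        (BPos.sum univ (fun z w => θ' z * _) fun z _ => (goodV z).smul (hθ' z))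
    refine (hslack.add hgoodmix).congr fun w => ?_
    -- Σ θ (slack + good) + Σ θ' (slack' + good') = (Σ θ + Σ θ') · P = P
    have eU : ∀ z, θ z * sideSlack (rooted z 𝒰) (rooted z 𝒱) w +
        θ z * ∑ B ∈ goodSideBlocks (rooted z 𝒰) (rooted z 𝒱), sideTerm (rooted z 𝒰) (rooted z 𝒱) B w = θ z * phiSet (n + 1) (mix 𝒰 𝒱 w) :=
      fun z => by rw [phiSet_mix_eq_slack_add_good_U 𝒰 𝒱 z w]; ring
    have eV : ∀ z, θ' z * sideSlack (rooted z 𝒱) (rooted z 𝒰) (1 - w) +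
        θ' z * ∑ B ∈ goodSideBlocks (rooted z 𝒱) (rooted z 𝒰), sideTerm (rooted z 𝒱) (rooted z 𝒰) B (1 - w) =
        θ' z * phiSet (n + 1) (mix 𝒰 𝒱 w) :=
      fun z => by rw [phiSet_mix_eq_slack_add_good_V 𝒰 𝒱 z w]; ring
    calc (∑ z, θ z * sideSlack (rooted z 𝒰) (rooted z 𝒱) w + ∑ z, θ' z * sideSlack (rooted z 𝒱) (rooted z 𝒰) (1 - w)) +
          (∑ z, θ z * ∑ B ∈ goodSideBlocks (rooted z 𝒰) (rooted z 𝒱), sideTerm (rooted z 𝒰) (rooted z 𝒱) B w +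
            ∑ z, θ' z * ∑ B ∈ goodSideBlocks (rooted z 𝒱) (rooted z 𝒰), sideTerm (rooted z 𝒱) (rooted z 𝒰) B (1 - w))
        = ∑ z, (θ z * sideSlack (rooted z 𝒰) (rooted z 𝒱) w +
            θ z * ∑ B ∈ goodSideBlocks (rooted z 𝒰) (rooted z 𝒱), sideTerm (rooted z 𝒰) (rooted z 𝒱) B w) +
          ∑ z, (θ' z * sideSlack (rooted z 𝒱) (rooted z 𝒰) (1 - w) +
            θ' z * ∑ B ∈ goodSideBlocks (rooted z 𝒱) (rooted z 𝒰), sideTerm (rooted z 𝒱) (rooted z 𝒰) B (1 - w)) := by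
          rw [Finset.sum_add_distrib, Finset.sum_add_distrib]; ring
      _ = (∑ z, θ z + ∑ z, θ' z) * phiSet (n + 1) (mix 𝒰 𝒱 w) := by
          rw [Finset.sum_congr rfl fun z _ => eU z, Finset.sum_congr rfl fun z _ => eV z, ← Finset.sum_mul, ← Finset.sum_mul]
          ring
      _ = phiSet (n + 1) (mix 𝒰 𝒱 w) := by rw [hsum, one_mul]
  intro 𝒰 𝒱 hU hV htop
  rcases htop with htopU | htopV
  · exact sideU 𝒰 𝒱 hU hV htopU
  · exact (sideU 𝒱 𝒰 hV hU htopV).reflect.congr fun w => by rw [mix_swap]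

end SideExpansion

end Summit.CriticalPhenomena.PercolationContinuityZ3.Theorems
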